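import Summits.Ventures.YMGap.RobustBall.LoopScreeningTilt
import HarnessLib

/-!
# Venture YMGap, track ROBUST-BALL — the plaquette first moment from ABOVE, I: two tilt lemmas

HONEST FRAMING. WHAT THIS IS: a venture file (cell `pub-ymgap`, track Y2, seat rb-p2 g6): two
elementary facts about tilted probability measures, the abstract half of the UPPER bound
`W_μ(1,1) ≤ u·e^{O(β)}` on the plaquette of every DLR state of lattice Yang–Mills
(`PlaquetteUpperMoment`, `PlaquetteLawTwoSided`). WHAT IT IS NOT: nothing gauge-theoretic yet, no
number of the cell, nothing about the continuum.

* `integral_tilted_sub_integral_le` — **response of the mean to a source, UPPER bound**: for a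
  probability measure `μ`, a measurable `X` with `|X| ≤ M` and `s ≥ 0`,
  `∫ X d(μ.tilted (sX)) - ∫ X dμ ≤ s e^{2sM} Var_μ(X)`, the mirror image of lit-1's lower bound
  `LoopScreening.integral_tilted_sub_integral_ge` (`s e^{-2sM} Var_μ(X) ≤ …`): the same covariance
  identity `⟨X⟩_s - ⟨X⟩_0 = Cov_μ(X, e^{sX}) / Z_s` with the pointwise UPPER estimate
  `(a - b)(e^{sa} - e^{sb}) ≤ s e^{sM} (a - b)²` (`mul_exp_sub_exp_le`) and `Z_s ≥ e^{-sM}`;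
* `abs_integral_tilted_le_of_integral_eq_zero` — **a tilt by an energy of oscillation `≤ D` moves a
  mean-zero observable bounded by `B` by at most `B (e^{D} - 1)`** (the density of the tilted
  measure lies in `[e^{-D}, e^{D}]`).

Everything is proved; no definition, no named fact. [folklore]
-/

noncomputable section

open MeasureTheory ProbabilityTheory Real Finset

namespace Summit.Ventures.YMGap.RobustBall

namespace PlaquetteUpperMoment

section Tilt

variable {Ω : Type*} [MeasurableSpace Ω] {X : Ω → ℝ} {M : ℝ}

/-- Pointwise input: for `0 ≤ s` and `|a|, |b| ≤ M`,
`(a - b)(e^{sa} - e^{sb}) ≤ s e^{sM} (a - b)²` (`1 - e^{-x} ≤ x`). [folklore] -/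
theorem mul_exp_sub_exp_le {s M a b : ℝ} (hs : 0 ≤ s) (ha : |a| ≤ M) (hb : |b| ≤ M) :
    (a - b) * (exp (s * a) - exp (s * b)) ≤ s * exp (s * M) * (a - b) ^ 2 := by
  have key : ∀ {a b : ℝ}, |a| ≤ M → b ≤ a →
      (a - b) * (exp (s * a) - exp (s * b)) ≤ s * exp (s * M) * (a - b) ^ 2 := by
    intro a b ha hab
    have haM : s * a ≤ s * M := mul_le_mul_of_nonneg_left (le_of_abs_le ha) hs
    have hab' : 0 ≤ a - b := sub_nonneg.2 hab
    have h1 : exp (s * a) - exp (s * b) ≤ exp (s * a) * (s * (a - b)) := by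
      have h := Real.add_one_le_exp (-(s * (a - b)))
      have : exp (s * b) = exp (s * a) * exp (-(s * (a - b))) := by
        rw [← Real.exp_add]; ring_nf
      rw [this]
      nlinarith [Real.exp_pos (s * a)]
    have h2 : exp (s * a) * (s * (a - b)) ≤ exp (s * M) * (s * (a - b)) :=
      mul_le_mul_of_nonneg_right (Real.exp_le_exp.2 haM) (by nlinarith)
    calc (a - b) * (exp (s * a) - exp (s * b)) ≤ (a - b) * (exp (s * a) * (s * (a - b))) :=
          mul_le_mul_of_nonneg_left h1 hab'
      _ ≤ (a - b) * (exp (s * M) * (s * (a - b))) := mul_le_mul_of_nonneg_left h2 hab'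
      _ = s * exp (s * M) * (a - b) ^ 2 := by ring
  rcases le_total b a with hab | hab
  · exact key ha hab
  · have := key hb hab
    calc (a - b) * (exp (s * a) - exp (s * b)) = (b - a) * (exp (s * b) - exp (s * a)) := by ring
      _ ≤ s * exp (s * M) * (b - a) ^ 2 := this
      _ = s * exp (s * M) * (a - b) ^ 2 := by ring

variable {μ : Measure Ω} [IsProbabilityMeasure μ]

/-- **Response of the mean to a source, upper bound.** For a probability measure `μ`, a measurable
observable `X` with `|X| ≤ M` and `s ≥ 0`, tilting `μ` by `e^{s X}` raises the mean of `X` by at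
most `s e^{2 s M} Var_μ(X)`:
`∫ X d(μ.tilted (s X)) - ∫ X dμ ≤ s e^{2sM} ∫ (X - ∫ X dμ)² dμ`
(`⟨X⟩_s - ⟨X⟩_0 = Cov_μ(X, e^{sX}) / Z_s`, `Cov_μ(X, e^{sX}) = ∫ (X - m)(e^{sX} - e^{sm}) dμ ≤
s e^{sM} Var_μ(X)` pointwise, and `Z_s ≥ e^{-sM}`). [folklore] -/
theorem integral_tilted_sub_integral_le (hX : Measurable X) (hM : ∀ ω, |X ω| ≤ M) {s : ℝ}
    (hs : 0 ≤ s) :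
    ∫ ω, X ω ∂(μ.tilted fun ω => s * X ω) - ∫ ω, X ω ∂μ ≤
      s * exp (2 * s * M) * ∫ ω, (X ω - ∫ ω', X ω' ∂μ) ^ 2 ∂μ := by
  set m : ℝ := ∫ ω', X ω' ∂μ with hm
  have hmM : |m| ≤ M := LoopScreening.abs_integral_le_of_abs_le hM
  have hi_exp : Integrable (fun ω => exp (s * X ω)) μ :=
    LoopScreening.integrable_comp_of_abs_le hX hM (f := fun x => exp (s * x)) (by fun_prop)
  have hi_expX : Integrable (fun ω => exp (s * X ω) * X ω) μ :=
    LoopScreening.integrable_comp_of_abs_le hX hM (f := fun x => exp (s * x) * x) (by fun_prop)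
  have hi_sq : Integrable (fun ω => (X ω - m) ^ 2) μ :=
    LoopScreening.integrable_comp_of_abs_le hX hM (f := fun x => (x - m) ^ 2) (by fun_prop)
  have hi_cov : Integrable (fun ω => (X ω - m) * (exp (s * X ω) - exp (s * m))) μ :=
    LoopScreening.integrable_comp_of_abs_le hX hM
      (f := fun x => (x - m) * (exp (s * x) - exp (s * m))) (by fun_prop)
  have hi_X : Integrable X μ :=
    LoopScreening.integrable_comp_of_abs_le hX hM (f := fun x => x) continuous_id
  -- the normaliser is at least `e^{-sM}`
  set Z : ℝ := ∫ ω, exp (s * X ω) ∂μ with hZ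
  have hZpos : 0 < Z := integral_exp_pos hi_exp
  have hZge : exp (-(s * M)) ≤ Z := by
    calc exp (-(s * M)) = ∫ _, exp (-(s * M)) ∂μ := by simp
      _ ≤ Z := integral_mono (integrable_const _) hi_exp fun ω => by
          refine Real.exp_le_exp.2 ?_
          have := (abs_le.1 (hM ω)).1
          nlinarith
  -- the tilted mean
  have htilt : ∫ ω, X ω ∂(μ.tilted fun ω => s * X ω) = (∫ ω, exp (s * X ω) * X ω ∂μ) / Z := by
    rw [integral_tilted]
    simp_rw [smul_eq_mul, ← hZ]
    rw [← integral_div]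
    refine integral_congr_ae (ae_of_all _ fun ω => ?_)
    ring
  -- the covariance identity
  have hcov : (∫ ω, exp (s * X ω) * X ω ∂μ) - m * Z =
      ∫ ω, (X ω - m) * (exp (s * X ω) - exp (s * m)) ∂μ := by
    have h1 : ∫ ω, (X ω - m) * (exp (s * X ω) - exp (s * m)) ∂μ =
        ∫ ω, (exp (s * X ω) * X ω - m * exp (s * X ω) - exp (s * m) * (X ω - m)) ∂μ :=
      integral_congr_ae (ae_of_all _ fun ω => by ring)
    have h2 : ∫ ω, (exp (s * X ω) * X ω - m * exp (s * X ω) - exp (s * m) * (X ω - m)) ∂μ =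
        (∫ ω, exp (s * X ω) * X ω ∂μ) - m * (∫ ω, exp (s * X ω) ∂μ) -
          exp (s * m) * ((∫ ω, X ω ∂μ) - m) := by
      have ha : Integrable (fun ω => exp (s * X ω) * X ω - m * exp (s * X ω)) μ :=
        hi_expX.sub (hi_exp.const_mul m)
      have hb : Integrable (fun ω => exp (s * m) * (X ω - m)) μ :=
        (hi_X.sub (integrable_const m)).const_mul _
      rw [integral_sub ha hb, integral_sub hi_expX (hi_exp.const_mul m), integral_const_mul,
        integral_const_mul, integral_sub hi_X (integrable_const m)]
      simp
    rw [h1, h2, ← hm, ← hZ, sub_self, mul_zero, sub_zero]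
  -- pointwise upper bound, integrated
  have hup : ∫ ω, (X ω - m) * (exp (s * X ω) - exp (s * m)) ∂μ ≤
      s * exp (s * M) * ∫ ω, (X ω - m) ^ 2 ∂μ := by
    have hcm : s * exp (s * M) * ∫ ω, (X ω - m) ^ 2 ∂μ = ∫ ω, s * exp (s * M) * (X ω - m) ^ 2 ∂μ :=
      (integral_const_mul _ _).symm
    rw [hcm]
    exact integral_mono hi_cov (hi_sq.const_mul _) fun ω => mul_exp_sub_exp_le hs (hM ω) hmM
  have hV0 : 0 ≤ ∫ ω, (X ω - m) ^ 2 ∂μ := integral_nonneg fun ω => sq_nonneg _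
  -- assemble
  rw [htilt]
  have hstep : (∫ ω, exp (s * X ω) * X ω ∂μ) / Z - m =
      (∫ ω, (X ω - m) * (exp (s * X ω) - exp (s * m)) ∂μ) / Z := by
    rw [← hcov]; field_simp
  rw [hstep]
  calc (∫ ω, (X ω - m) * (exp (s * X ω) - exp (s * m)) ∂μ) / Z
      ≤ (s * exp (s * M) * ∫ ω, (X ω - m) ^ 2 ∂μ) / Z := div_le_div_of_nonneg_right hup hZpos.le
    _ ≤ (s * exp (s * M) * ∫ ω, (X ω - m) ^ 2 ∂μ) / exp (-(s * M)) :=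
        div_le_div_of_nonneg_left (by positivity) (Real.exp_pos _) hZge
    _ = s * exp (2 * s * M) * ∫ ω, (X ω - m) ^ 2 ∂μ := by
        rw [Real.exp_neg, div_inv_eq_mul, show 2 * s * M = s * M + s * M by ring, Real.exp_add]
        ring

/-- **A tilt of bounded oscillation moves a mean-zero observable by at most `B (e^{D} - 1)`.** If
`a ≤ φ ≤ a + D`, `|F| ≤ B` and `∫ F dν = 0` for a probability measure `ν`, then
`|∫ F d(ν.tilted φ)| ≤ B (e^{D} - 1)` (the density `e^{φ}/Z` lies in `[e^{-D}, e^{D}]`, and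
`1 - e^{-D} ≤ e^{D} - 1`). [folklore] -/
theorem abs_integral_tilted_le_of_integral_eq_zero {ν : Measure Ω} [IsProbabilityMeasure ν]
    {F : Ω → ℝ} (hF : Measurable F) {B : ℝ} (hB : ∀ ω, |F ω| ≤ B) (h0 : ∫ ω, F ω ∂ν = 0)
    {φ : Ω → ℝ} (hφm : Measurable φ) {a D : ℝ} (hφ : ∀ ω, a ≤ φ ω ∧ φ ω ≤ a + D) :
    |∫ ω, F ω ∂(ν.tilted φ)| ≤ B * (Real.exp D - 1) := by
  have hi_exp : Integrable (fun ω => exp (φ ω)) ν :=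
    Integrable.of_bound hφm.exp.aestronglyMeasurable (exp (a + D)) (ae_of_all _ fun ω => by
      rw [Real.norm_eq_abs, Real.abs_exp]; exact Real.exp_le_exp.2 (hφ ω).2)
  set Z : ℝ := ∫ ω, exp (φ ω) ∂ν with hZ
  have hZpos : 0 < Z := integral_exp_pos hi_exp
  have hZge : exp a ≤ Z := by
    calc exp a = ∫ _, exp a ∂ν := by simp
      _ ≤ Z := integral_mono (integrable_const _) hi_exp fun ω => Real.exp_le_exp.2 (hφ ω).1
  have hZle : Z ≤ exp (a + D) := by
    calc Z ≤ ∫ _, exp (a + D) ∂ν := integral_mono hi_exp (integrable_const _) fun ω =>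
          Real.exp_le_exp.2 (hφ ω).2
      _ = exp (a + D) := by simp
  -- the density ratio
  have hr : ∀ ω, |exp (φ ω) / Z - 1| ≤ exp D - 1 := by
    intro ω
    have hlo : exp (-D) ≤ exp (φ ω) / Z := by
      rw [le_div_iff₀ hZpos]
      calc exp (-D) * Z ≤ exp (-D) * exp (a + D) := mul_le_mul_of_nonneg_left hZle (Real.exp_nonneg _)
        _ = exp a := by rw [← Real.exp_add]; ring_nf
        _ ≤ exp (φ ω) := Real.exp_le_exp.2 (hφ ω).1
    have hhi : exp (φ ω) / Z ≤ exp D := by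
      rw [div_le_iff₀ hZpos]
      calc exp (φ ω) ≤ exp (a + D) := Real.exp_le_exp.2 (hφ ω).2
        _ = exp D * exp a := by rw [← Real.exp_add]; ring_nf
        _ ≤ exp D * Z := mul_le_mul_of_nonneg_left hZge (Real.exp_nonneg _)
    have h1 := Real.add_one_le_exp D
    have h2 := Real.add_one_le_exp (-D)
    rw [abs_le]
    constructor <;> linarith
  -- integrability
  have hiF : Integrable F ν :=
    Integrable.of_bound hF.aestronglyMeasurable B (ae_of_all _ fun ω => by
      rw [Real.norm_eq_abs]; exact hB ω)
  have hi1 : Integrable (fun ω => exp (φ ω) / Z * F ω) ν := by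
    refine Integrable.of_bound ((hφm.exp.div_const Z).mul hF).aestronglyMeasurable (exp D * B)
      (ae_of_all _ fun ω => ?_)
    rw [Real.norm_eq_abs, abs_mul, abs_of_nonneg (by positivity : 0 ≤ exp (φ ω) / Z)]
    have hhi : exp (φ ω) / Z ≤ exp D := by linarith [(abs_le.1 (hr ω)).2]
    exact mul_le_mul hhi (hB ω) (abs_nonneg _) (Real.exp_nonneg _)
  rw [integral_tilted]
  simp_rw [smul_eq_mul, ← hZ]
  have hrew : ∫ ω, exp (φ ω) / Z * F ω ∂ν = ∫ ω, (exp (φ ω) / Z - 1) * F ω ∂ν := by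
    calc ∫ ω, exp (φ ω) / Z * F ω ∂ν = (∫ ω, exp (φ ω) / Z * F ω ∂ν) - ∫ ω, F ω ∂ν := by
          rw [h0, sub_zero]
      _ = ∫ ω, (exp (φ ω) / Z * F ω - F ω) ∂ν := (integral_sub hi1 hiF).symm
      _ = ∫ ω, (exp (φ ω) / Z - 1) * F ω ∂ν := integral_congr_ae (ae_of_all _ fun ω => by ring)
  rw [hrew]
  have hD1 : ∀ ω, 0 ≤ exp D - 1 := fun ω => (abs_nonneg _).trans (hr ω)
  calc |∫ ω, (exp (φ ω) / Z - 1) * F ω ∂ν| ≤ ∫ ω, |(exp (φ ω) / Z - 1) * F ω| ∂ν :=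
        abs_integral_le_integral_abs
    _ ≤ ∫ _ω, (exp D - 1) * B ∂ν := by
        refine integral_mono_of_nonneg (ae_of_all _ fun ω => abs_nonneg _) (integrable_const _)
          (ae_of_all _ fun ω => ?_)
        dsimp only
        rw [abs_mul]
        exact mul_le_mul (hr ω) (hB ω) (abs_nonneg _) (hD1 ω)
    _ = B * (exp D - 1) := by simp [mul_comm]

end Tilt

end PlaquetteUpperMoment

end Summit.Ventures.YMGap.RobustBall
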